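import Summits.Ventures.PercRepro.MSTightTighteningSplit

/-!
# Conjecture (T) at a tightening direction, in terms of the partnerless members

Dossier proofs/MINE1-theoremS.md, Addendum 50 §6. For a family `F` and an element `r` the
differences `Y = F₁ \\ F₀` split into the four blocks `K \\ K`, `K \\ P₀`, `P₁ \\ K`, `P₁ \\ P₀`
(`P₀ = F₀ ∖ F₁`, `P₁ = F₁ ∖ F₀` the partnerless members), and the first three lie in `X ∩ Y`
(`MSTightTighteningSplit`). Hence **`Y ⊆ X` iff `P₁ \\ P₀ ⊆ X ∩ Y`**
(`diffsY_subset_diffsX_iff_partnerless`); at a tightening direction of an excess-one family, in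
case (β) of the tightening split (`X ∩ Y = K \\ K`) **Conjecture (T) reads «every difference of a
partnerless `r`-member against a partnerless `r`-free member is a difference of the partner
family»** (`diffsY_subset_diffsX_iff_of_beta`), and in case (α) (`X ∩ Y = K \\ K ∪ {e}`) «… is a
partner difference or the single extra difference `e`» (`diffsY_subset_diffsX_iff_of_alpha`).
This is the open piece of the lane in its simplest form: no trace structure enters the statement,
only the partner family and the partnerless members.
-/

namespace PercRepro.MSTight

open Finset
open scoped FinsetFamily

variable {α : Type*} [DecidableEq α] {r : α} {F : Finset (Finset α)}

/-- **`Y ⊆ X` iff the partnerless block `P₁ \\ P₀` lies in `X ∩ Y`.** -/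
theorem diffsY_subset_diffsX_iff_partnerless :
    diffsY r F ⊆ diffsX r F ↔
      (partr r F \ part0 r F) \\ (part0 r F \ partr r F) ⊆ diffsX r F ∩ diffsY r F := by
  constructor
  · intro h E hE
    have hY : E ∈ diffsY r F := by
      rw [diffsY]
      exact diffs_subset sdiff_subset sdiff_subset hE
    exact mem_inter.2 ⟨h hY, hY⟩
  · intro h E hE
    obtain ⟨t, ht, s, hs, rfl⟩ := mem_diffs.1 hE
    by_cases ht0 : t ∈ part0 r F
    · have hk : t ∈ partner r F := mem_inter.2 ⟨ht0, ht⟩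
      exact (mem_inter.1 (sdiff_mem_inter_of_mem_partner_of_mem_part0 hk hs)).1
    by_cases hs1 : s ∈ partr r F
    · have hk : s ∈ partner r F := mem_inter.2 ⟨hs, hs1⟩
      exact (mem_inter.1 (sdiff_mem_inter_of_mem_partr_of_mem_partner ht hk)).1
    · exact (mem_inter.1 (h (mem_diffs.2 ⟨t, mem_sdiff.2 ⟨ht, ht0⟩, s,
        mem_sdiff.2 ⟨hs, hs1⟩, rfl⟩))).1

/-- **Case (β): Conjecture (T) says exactly that every difference of a partnerless `r`-member
against a partnerless `r`-free member is a difference of the partner family.** -/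
theorem diffsY_subset_diffsX_iff_of_beta
    (hβ : diffsX r F ∩ diffsY r F = partner r F \\ partner r F) :
    diffsY r F ⊆ diffsX r F ↔
      (partr r F \ part0 r F) \\ (part0 r F \ partr r F) ⊆ partner r F \\ partner r F := by
  rw [diffsY_subset_diffsX_iff_partnerless, hβ]

/-- **Case (α): Conjecture (T) says that every such difference is a partner difference or the
single extra difference `e`.** -/
theorem diffsY_subset_diffsX_iff_of_alpha {e : Finset α}
    (hα : diffsX r F ∩ diffsY r F = insert e (partner r F \\ partner r F)) :
    diffsY r F ⊆ diffsX r F ↔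
      (partr r F \ part0 r F) \\ (part0 r F \ partr r F) ⊆
        insert e (partner r F \\ partner r F) := by
  rw [diffsY_subset_diffsX_iff_partnerless, hα]

end PercRepro.MSTight
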